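import Mathlib
import Summits.Ventures.PercRepro2.CoinKSureAD
import Summits.Ventures.PercRepro2.CoinChainWorld1

/-!
# The chain functional when the PIVOTAL law has nonpositive marker covariance
(blind cell PercRepro2, night-2 g21; proofs/NIGHT2-DARC.md §61.7)

`T(R, G) = T(R, R) − T(R, P)` with `P = R − G ≥ 0` the pivotal mass (the cleared functional is
linear in the gate).  `T(R, R) = Λ · (Λ ∑ R x y − ∑ R x ∑ R y) ≥ 0` by FKG for the log-supermodular
`R`-law.  If the gate shifts `(∑ G x · Λ − Λ₁ ∑ G, ∑ G y · Λ − Λ₂ ∑ G)` have the same sign, FKG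
for the gate gives `T ≥ 0` directly (`gate_functional_nonneg_of_sameShift`); otherwise the
pivotal shifts — the NEGATIVES of the gate shifts — have opposite signs too, and with
`Cov_P(x, y) ≤ 0` the cleared pivotal functional `T(R, P)` is `≤ 0`, so `T(R, G) ≥ T(R, R) ≥ 0`
(`gate_functional_nonneg_of_pivotalCov`).  For the AND-switch chain the pivotal mass is
`ν · (chainMix ent ent' ρ c d − chainMix ent ent' ρ c d')` (`chain_functional_nonneg_of_pivotalCov`).
The condition is the natural one in the ANTI-ALIGNED residual of §61.6 (product cores: every
anti-aligned check of the census has `Cov_P ≤ 0`).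
-/

namespace Summit.Ventures.PercRepro2.Coin

open Classical

section PivotalCovAbstract

variable {V : Type*} [DecidableEq V] {R : Type*} [Field R] [LinearOrder R] [IsStrictOrderedRing R]

omit [DecidableEq V] [LinearOrder R] [IsStrictOrderedRing R] in
/-- The cleared functional in terms of the centred shifts: `G₀ · T = (Λ ∑Gx − Λ₁ G₀)(Λ ∑Gy − Λ₂ G₀)
+ Λ² (G₀ ∑Gxy − ∑Gx ∑Gy)`. -/
lemma functional_shift_identity (Λ Λ₁ Λ₂ G₀ Gx Gy Gxy : R) :
    G₀ * (Λ ^ 2 * Gxy - Λ * Λ₁ * Gy - Λ * Λ₂ * Gx + Λ₁ * Λ₂ * G₀) =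
      (Λ * Gx - Λ₁ * G₀) * (Λ * Gy - Λ₂ * G₀) + Λ ^ 2 * (G₀ * Gxy - Gx * Gy) := by ring

/-- **FKG of the `R`-law**: `Λ ∑ R x y ≥ ∑ R x · ∑ R y` for increasing nonnegative markers. -/
lemma law_fkg (U : Finset V) (G x y : Finset V → R) (hG : ∀ W, 0 ≤ G W)
    (hx0 : ∀ W, 0 ≤ x W) (hy0 : ∀ W, 0 ≤ y W)
    (hxm : ∀ s t, x s ≤ x (s ∪ t)) (hym : ∀ s t, y s ≤ y (s ∪ t))
    (wLL : ∀ s ⊆ U, ∀ t ⊆ U, G s * G t ≤ G (s ∩ t) * G (s ∪ t)) :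
    (∑ W ∈ U.powerset, G W * x W) * (∑ W ∈ U.powerset, G W * y W) ≤
      (∑ W ∈ U.powerset, G W) * (∑ W ∈ U.powerset, G W * (x W * y W)) := by
  have n₁ : ∀ W, 0 ≤ G W * x W := fun W => mul_nonneg (hG W) (hx0 W)
  have n₂ : ∀ W, 0 ≤ G W * y W := fun W => mul_nonneg (hG W) (hy0 W)
  have n₄ : ∀ W, 0 ≤ G W * (x W * y W) := fun W => mul_nonneg (hG W) (mul_nonneg (hx0 W) (hy0 W))
  refine ad_pointwise U _ _ _ _ n₁ n₂ hG n₄ ?_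
  intro s hs t ht
  have hxs : x s ≤ x (s ∪ t) := hxm s t
  have hyt : y t ≤ y (s ∪ t) := by rw [Finset.union_comm]; exact hym t s
  calc G s * x s * (G t * y t) = (G s * G t) * (x s * y t) := by ring
    _ ≤ (G (s ∩ t) * G (s ∪ t)) * (x (s ∪ t) * y (s ∪ t)) :=
        mul_le_mul (wLL s hs t ht) (mul_le_mul hxs hyt (hy0 t) (hx0 _))
          (mul_nonneg (hx0 s) (hy0 t)) (mul_nonneg (hG _) (hG _))
    _ = G (s ∩ t) * (G (s ∪ t) * (x (s ∪ t) * y (s ∪ t))) := by ring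

/-- **THE GATE FUNCTIONAL WHEN THE PIVOTAL LAW IS NEGATIVELY CORRELATED.** `G` the `R`-law and
`G'` the gate, both log-supermodular, `G' ≤ G`; if the pivotal mass `G − G'` has nonpositive
marker covariance (`hP`, cleared), the cleared functional is nonnegative. -/
theorem gate_functional_nonneg_of_pivotalCov (U : Finset V) (G G' x y : Finset V → R)
    (hG : ∀ W, 0 ≤ G W) (hG' : ∀ W, 0 ≤ G' W) (hle : ∀ W, G' W ≤ G W)
    (hx0 : ∀ W, 0 ≤ x W) (hy0 : ∀ W, 0 ≤ y W)
    (hxm : ∀ s t, x s ≤ x (s ∪ t)) (hym : ∀ s t, y s ≤ y (s ∪ t))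
    (wLL : ∀ s ⊆ U, ∀ t ⊆ U, G s * G t ≤ G (s ∩ t) * G (s ∪ t))
    (wMM : ∀ s ⊆ U, ∀ t ⊆ U, G' s * G' t ≤ G' (s ∩ t) * G' (s ∪ t))
    (hP : (∑ W ∈ U.powerset, (G W - G' W)) * (∑ W ∈ U.powerset, (G W - G' W) * (x W * y W)) ≤
        (∑ W ∈ U.powerset, (G W - G' W) * x W) * (∑ W ∈ U.powerset, (G W - G' W) * y W)) :
    0 ≤ (∑ W ∈ U.powerset, G W) ^ 2 * (∑ W ∈ U.powerset, G' W * (x W * y W))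
        - (∑ W ∈ U.powerset, G W) * (∑ W ∈ U.powerset, G W * x W) *
          (∑ W ∈ U.powerset, G' W * y W)
        - (∑ W ∈ U.powerset, G W) * (∑ W ∈ U.powerset, G W * y W) *
          (∑ W ∈ U.powerset, G' W * x W)
        + (∑ W ∈ U.powerset, G W * x W) * (∑ W ∈ U.powerset, G W * y W) *
          (∑ W ∈ U.powerset, G' W) := by
  -- the moments of the `R`-law, the gate and the pivotal mass
  have hR := law_fkg U G x y hG hx0 hy0 hxm hym wLL
  have hGf := law_fkg U G' x y hG' hx0 hy0 hxm hym wMM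
  have hP0 : ∀ W, 0 ≤ G W - G' W := fun W => sub_nonneg.mpr (hle W)
  -- split every gate sum as the `R`-sum minus the pivotal sum
  have e0 : (∑ W ∈ U.powerset, G' W) = (∑ W ∈ U.powerset, G W) - ∑ W ∈ U.powerset, (G W - G' W) := by
    rw [← Finset.sum_sub_distrib]; exact Finset.sum_congr rfl fun W _ => by ring
  have ex : (∑ W ∈ U.powerset, G' W * x W) =
      (∑ W ∈ U.powerset, G W * x W) - ∑ W ∈ U.powerset, (G W - G' W) * x W := by
    rw [← Finset.sum_sub_distrib]; exact Finset.sum_congr rfl fun W _ => by ring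
  have ey : (∑ W ∈ U.powerset, G' W * y W) =
      (∑ W ∈ U.powerset, G W * y W) - ∑ W ∈ U.powerset, (G W - G' W) * y W := by
    rw [← Finset.sum_sub_distrib]; exact Finset.sum_congr rfl fun W _ => by ring
  have exy : (∑ W ∈ U.powerset, G' W * (x W * y W)) =
      (∑ W ∈ U.powerset, G W * (x W * y W)) - ∑ W ∈ U.powerset, (G W - G' W) * (x W * y W) := by
    rw [← Finset.sum_sub_distrib]; exact Finset.sum_congr rfl fun W _ => by ring
  generalize hΛ : (∑ W ∈ U.powerset, G W) = Λ at hR e0 ⊢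
  generalize hΛ₁ : (∑ W ∈ U.powerset, G W * x W) = Λ₁ at hR ex ⊢
  generalize hΛ₂ : (∑ W ∈ U.powerset, G W * y W) = Λ₂ at hR ey ⊢
  generalize hΛ₁₂ : (∑ W ∈ U.powerset, G W * (x W * y W)) = Λ₁₂ at hR exy
  generalize hM : (∑ W ∈ U.powerset, G' W) = M at hGf e0 ⊢
  generalize hMx : (∑ W ∈ U.powerset, G' W * x W) = Mx at hGf ex ⊢
  generalize hMy : (∑ W ∈ U.powerset, G' W * y W) = My at hGf ey ⊢
  generalize hMxy : (∑ W ∈ U.powerset, G' W * (x W * y W)) = Mxy at hGf exy ⊢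
  generalize hP₀ : (∑ W ∈ U.powerset, (G W - G' W)) = P₀ at hP e0
  generalize hPx : (∑ W ∈ U.powerset, (G W - G' W) * x W) = Px at hP ex
  generalize hPy : (∑ W ∈ U.powerset, (G W - G' W) * y W) = Py at hP ey
  generalize hPxy : (∑ W ∈ U.powerset, (G W - G' W) * (x W * y W)) = Pxy at hP exy
  have hΛ0 : 0 ≤ Λ := by rw [← hΛ]; exact Finset.sum_nonneg fun W _ => hG W
  have hM0 : 0 ≤ M := by rw [← hM]; exact Finset.sum_nonneg fun W _ => hG' W
  have hP00 : 0 ≤ P₀ := by rw [← hP₀]; exact Finset.sum_nonneg fun W _ => hP0 W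
  -- the two cases: the gate shifts of the same sign, or the pivotal shifts of opposite signs
  have key := functional_shift_identity Λ Λ₁ Λ₂ M Mx My Mxy
  by_cases hsame : 0 ≤ (Λ * Mx - Λ₁ * M) * (Λ * My - Λ₂ * M)
  · -- FKG of the gate
    by_cases hM0' : M = 0
    · -- the gate vanishes
      have hall : ∀ W ∈ U.powerset, G' W = 0 := fun W hW =>
        (Finset.sum_eq_zero_iff_of_nonneg (fun W _ => hG' W)).mp (by rw [hM]; exact hM0') W hW
      have z1 : Mx = 0 := by rw [← hMx]; exact Finset.sum_eq_zero fun W hW => by rw [hall W hW, zero_mul]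
      have z2 : My = 0 := by rw [← hMy]; exact Finset.sum_eq_zero fun W hW => by rw [hall W hW, zero_mul]
      have z3 : Mxy = 0 := by rw [← hMxy]; exact Finset.sum_eq_zero fun W hW => by rw [hall W hW, zero_mul]
      rw [hM0', z1, z2, z3]; ring_nf; exact le_rfl
    · have hMpos : 0 < M := lt_of_le_of_ne hM0 (Ne.symm hM0')
      have h2 : 0 ≤ Λ ^ 2 * (M * Mxy - Mx * My) := mul_nonneg (sq_nonneg Λ) (by linarith [hGf])
      have h3 : 0 ≤ M * (Λ ^ 2 * Mxy - Λ * Λ₁ * My - Λ * Λ₂ * Mx + Λ₁ * Λ₂ * M) := by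
        rw [key]; exact add_nonneg hsame h2
      have h4 : 0 ≤ Λ ^ 2 * Mxy - Λ * Λ₁ * My - Λ * Λ₂ * Mx + Λ₁ * Λ₂ * M :=
        (mul_nonneg_iff_of_pos_left hMpos).mp h3
      linarith [h4]
  · -- opposite gate shifts: the pivotal shifts are the negatives of the gate shifts
    have hopp : (Λ * Px - Λ₁ * P₀) * (Λ * Py - Λ₂ * P₀) ≤ 0 := by
      have e1 : Λ * Px - Λ₁ * P₀ = -(Λ * Mx - Λ₁ * M) := by rw [ex, e0]; ring
      have e2 : Λ * Py - Λ₂ * P₀ = -(Λ * My - Λ₂ * M) := by rw [ey, e0]; ring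
      rw [e1, e2]; linarith [not_le.mp hsame]
    -- `T(R, G') = T(R, R) − T(R, P)`; `T(R, R) ≥ 0` by FKG, `P₀ · T(R, P) ≤ (pivotal shift product) ≤ 0`
    have hTRR : 0 ≤ Λ ^ 2 * Λ₁₂ - Λ * Λ₁ * Λ₂ - Λ * Λ₂ * Λ₁ + Λ₁ * Λ₂ * Λ := by
      have : Λ ^ 2 * Λ₁₂ - Λ * Λ₁ * Λ₂ - Λ * Λ₂ * Λ₁ + Λ₁ * Λ₂ * Λ = Λ * (Λ * Λ₁₂ - Λ₁ * Λ₂) := by ring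
      rw [this]; exact mul_nonneg hΛ0 (by linarith [hR])
    have hTRP : P₀ * (Λ ^ 2 * Pxy - Λ * Λ₁ * Py - Λ * Λ₂ * Px + Λ₁ * Λ₂ * P₀) ≤ 0 := by
      have := functional_shift_identity Λ Λ₁ Λ₂ P₀ Px Py Pxy
      rw [this]
      have h2 : Λ ^ 2 * (P₀ * Pxy - Px * Py) ≤ 0 := mul_nonpos_of_nonneg_of_nonpos (sq_nonneg Λ) (by linarith [hP])
      linarith [hopp, h2]
    have hsplit : Λ ^ 2 * Mxy - Λ * Λ₁ * My - Λ * Λ₂ * Mx + Λ₁ * Λ₂ * M =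
        (Λ ^ 2 * Λ₁₂ - Λ * Λ₁ * Λ₂ - Λ * Λ₂ * Λ₁ + Λ₁ * Λ₂ * Λ) -
          (Λ ^ 2 * Pxy - Λ * Λ₁ * Py - Λ * Λ₂ * Px + Λ₁ * Λ₂ * P₀) := by
      rw [exy, ex, ey, e0]; ring
    rw [hsplit]
    by_cases hP0' : P₀ = 0
    · have hall : ∀ W ∈ U.powerset, G W - G' W = 0 := fun W hW =>
        (Finset.sum_eq_zero_iff_of_nonneg (fun W _ => hP0 W)).mp (by rw [hP₀]; exact hP0') W hW
      have z1 : Px = 0 := by rw [← hPx]; exact Finset.sum_eq_zero fun W hW => by rw [hall W hW, zero_mul]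
      have z2 : Py = 0 := by rw [← hPy]; exact Finset.sum_eq_zero fun W hW => by rw [hall W hW, zero_mul]
      have z3 : Pxy = 0 := by rw [← hPxy]; exact Finset.sum_eq_zero fun W hW => by rw [hall W hW, zero_mul]
      rw [hP0', z1, z2, z3]; ring_nf; linarith [hTRR]
    · have hPpos : 0 < P₀ := lt_of_le_of_ne hP00 (Ne.symm hP0')
      have : Λ ^ 2 * Pxy - Λ * Λ₁ * Py - Λ * Λ₂ * Px + Λ₁ * Λ₂ * P₀ ≤ 0 :=
        (mul_nonpos_iff_pos_imp_nonpos.mp hTRP).1 hPpos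
      linarith [hTRR]

end PivotalCovAbstract

section PivotalCovChain

variable {V : Type*} [DecidableEq V] {R : Type*} [Field R] [LinearOrder R] [IsStrictOrderedRing R]

/-- The gate mixture is below the `R`-law mixture when `d' ≤ d`. -/
lemma chainMix_le_of_le (ent ent' : Finset V) {ρ : R} (hρ0 : 0 ≤ ρ) (hρ1 : ρ ≤ 1)
    {c d d' : Finset V → R} (hd'd : ∀ W, d' W ≤ d W) (W : Finset V) :
    chainMix ent ent' ρ c d' W ≤ chainMix ent ent' ρ c d W := by
  unfold chainMix
  have h0 := chainTheta_nonneg ent ent' hρ0 W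
  have h1 := chainTheta_le_one ent ent' hρ1 W
  have := hd'd W
  nlinarith

/-- **THE AND-SWITCH CHAIN WHEN THE PIVOTAL LAW IS NEGATIVELY CORRELATED.** `R_ρ = ν · chainMix ent
ent' ρ c d`, `G_ρ = ν · chainMix ent ent' ρ c d'` (head hypotheses of `mixture_lsm` for `(c, d)`
and `(c, d')`); if the pivotal mass `ν · (chainMix ρ c d − chainMix ρ c d')` has nonpositive marker
covariance (`hP`, cleared), the chain functional is nonnegative. -/
theorem chain_functional_nonneg_of_pivotalCov (U ent ent' : Finset V) (ν c d d' : Finset V → R)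
    (ρ : R) (hρ0 : 0 ≤ ρ) (hρ1 : ρ ≤ 1) (hν0 : ∀ W, 0 ≤ ν W)
    (hν : ∀ s ⊆ U, ∀ t ⊆ U, ν s * ν t ≤ ν (s ∩ t) * ν (s ∪ t))
    (hc0 : ∀ W, 0 ≤ c W) (hd0 : ∀ W, 0 ≤ d W) (hd'0 : ∀ W, 0 ≤ d' W)
    (hdc : ∀ W, d W ≤ c W) (hd'c : ∀ W, d' W ≤ c W) (hd'd : ∀ W, d' W ≤ d W)
    (hcc : ∀ s t, c s * c t ≤ c (s ∩ t) * c (s ∪ t))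
    (hdd : ∀ s t, d s * d t ≤ d (s ∩ t) * d (s ∪ t))
    (hd'd' : ∀ s t, d' s * d' t ≤ d' (s ∩ t) * d' (s ∪ t))
    (hcd : ∀ s t, c s * d t ≤ c (s ∩ t) * d (s ∪ t))
    (hcd' : ∀ s t, c s * d' t ≤ c (s ∩ t) * d' (s ∪ t))
    (hratio : ∀ s t, s ⊆ t → d s * c t ≤ c s * d t)
    (hratio' : ∀ s t, s ⊆ t → d' s * c t ≤ c s * d' t)
    (x y : Finset V → R) (hx0 : ∀ W, 0 ≤ x W) (hy0 : ∀ W, 0 ≤ y W)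
    (hxm : ∀ s t, x s ≤ x (s ∪ t)) (hym : ∀ s t, y s ≤ y (s ∪ t))
    (hP : (∑ W ∈ U.powerset, ν W * (chainMix ent ent' ρ c d W - chainMix ent ent' ρ c d' W)) *
          (∑ W ∈ U.powerset, ν W * (chainMix ent ent' ρ c d W - chainMix ent ent' ρ c d' W) *
            (x W * y W)) ≤
        (∑ W ∈ U.powerset, ν W * (chainMix ent ent' ρ c d W - chainMix ent ent' ρ c d' W) * x W) *
          (∑ W ∈ U.powerset, ν W * (chainMix ent ent' ρ c d W - chainMix ent ent' ρ c d' W) * y W)) :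
    0 ≤ (∑ W ∈ U.powerset, ν W * chainMix ent ent' ρ c d W) ^ 2 *
          (∑ W ∈ U.powerset, ν W * chainMix ent ent' ρ c d' W * (x W * y W))
        - (∑ W ∈ U.powerset, ν W * chainMix ent ent' ρ c d W) *
          (∑ W ∈ U.powerset, ν W * chainMix ent ent' ρ c d W * x W) *
          (∑ W ∈ U.powerset, ν W * chainMix ent ent' ρ c d' W * y W)
        - (∑ W ∈ U.powerset, ν W * chainMix ent ent' ρ c d W) *
          (∑ W ∈ U.powerset, ν W * chainMix ent ent' ρ c d W * y W) *
          (∑ W ∈ U.powerset, ν W * chainMix ent ent' ρ c d' W * x W)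
        + (∑ W ∈ U.powerset, ν W * chainMix ent ent' ρ c d W * x W) *
          (∑ W ∈ U.powerset, ν W * chainMix ent ent' ρ c d W * y W) *
          (∑ W ∈ U.powerset, ν W * chainMix ent ent' ρ c d' W) := by
  set G : Finset V → R := fun W => ν W * chainMix ent ent' ρ c d W with hGdef
  set G' : Finset V → R := fun W => ν W * chainMix ent ent' ρ c d' W with hG'def
  have hm0 : ∀ W, 0 ≤ chainMix ent ent' ρ c d W := chainMix_nonneg ent ent' hρ0 hρ1 hc0 hd0
  have hm'0 : ∀ W, 0 ≤ chainMix ent ent' ρ c d' W := chainMix_nonneg ent ent' hρ0 hρ1 hc0 hd'0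
  have hG0 : ∀ W, 0 ≤ G W := fun W => mul_nonneg (hν0 W) (hm0 W)
  have hG'0 : ∀ W, 0 ≤ G' W := fun W => mul_nonneg (hν0 W) (hm'0 W)
  have hle : ∀ W, G' W ≤ G W := fun W =>
    mul_le_mul_of_nonneg_left (chainMix_le_of_le ent ent' hρ0 hρ1 hd'd W) (hν0 W)
  have hmix := mixture_lsm ent ent' ρ hρ0 hρ1 c d hc0 hd0 hdc hcc hdd hcd hratio
  have hmix' := mixture_lsm ent ent' ρ hρ0 hρ1 c d' hc0 hd'0 hd'c hcc hd'd' hcd' hratio'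
  have wLL : ∀ s ⊆ U, ∀ t ⊆ U, G s * G t ≤ G (s ∩ t) * G (s ∪ t) := by
    intro s hs t ht
    simp only [hGdef]
    calc ν s * chainMix ent ent' ρ c d s * (ν t * chainMix ent ent' ρ c d t)
        = (ν s * ν t) * (chainMix ent ent' ρ c d s * chainMix ent ent' ρ c d t) := by ring
      _ ≤ (ν (s ∩ t) * ν (s ∪ t)) *
            (chainMix ent ent' ρ c d (s ∩ t) * chainMix ent ent' ρ c d (s ∪ t)) :=
          mul_le_mul (hν s hs t ht) (hmix s t) (mul_nonneg (hm0 _) (hm0 _))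
            (mul_nonneg (hν0 _) (hν0 _))
      _ = _ := by ring
  have wMM : ∀ s ⊆ U, ∀ t ⊆ U, G' s * G' t ≤ G' (s ∩ t) * G' (s ∪ t) := by
    intro s hs t ht
    simp only [hG'def]
    calc ν s * chainMix ent ent' ρ c d' s * (ν t * chainMix ent ent' ρ c d' t)
        = (ν s * ν t) * (chainMix ent ent' ρ c d' s * chainMix ent ent' ρ c d' t) := by ring
      _ ≤ (ν (s ∩ t) * ν (s ∪ t)) *
            (chainMix ent ent' ρ c d' (s ∩ t) * chainMix ent ent' ρ c d' (s ∪ t)) :=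
          mul_le_mul (hν s hs t ht) (hmix' s t) (mul_nonneg (hm'0 _) (hm'0 _))
            (mul_nonneg (hν0 _) (hν0 _))
      _ = _ := by ring
  have hPdiff : ∀ W, G W - G' W = ν W * (chainMix ent ent' ρ c d W - chainMix ent ent' ρ c d' W) :=
    fun W => by simp only [hGdef, hG'def]; ring
  have hP' : (∑ W ∈ U.powerset, (G W - G' W)) * (∑ W ∈ U.powerset, (G W - G' W) * (x W * y W)) ≤
      (∑ W ∈ U.powerset, (G W - G' W) * x W) * (∑ W ∈ U.powerset, (G W - G' W) * y W) := by
    simpa only [hPdiff] using hP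
  exact gate_functional_nonneg_of_pivotalCov U G G' x y hG0 hG'0 hle hx0 hy0 hxm hym wLL wMM hP'

end PivotalCovChain

end Summit.Ventures.PercRepro2.Coin
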